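import Literature.MathematicalPhysics.QuantumFieldTheory.Balaban1983to89.B9SectBKerLettersY
import Literature.MathematicalPhysics.QuantumFieldTheory.Balaban1983to89.B9SectBKerFrameV3
import Literature.MathematicalPhysics.QuantumFieldTheory.Balaban1983to89.B9SectBStepsKSCU
import Literature.MathematicalPhysics.QuantumFieldTheory.Balaban1983to89.B9Thm39ReadingAtLetters

/-!
# Balaban [B9], Thm 3.2 (3.48) p. 398 + (3.65)–(3.67) p. 403 — ★★★ THE C⁻¹ = (Q′G′²Q′*)⁻¹ MEMBER OF THE SECT.-B STEP OF RECORD (R13-U1) OVER THE CODED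
# CARRIERS OF NODE 00: the (3.48) kernel READ ∕ WRITE dictionary (§1), the (3.57)∕(3.59) variation letters under the transporter-variation law `VarParY` (§2),
# discharged from g7's `CplxLettersY` (§2b), the instance ★★ `cinvFrame₃CodedOn` of `B9SectBKerFrameV3.CinvFrame₃` and the steps ★★ `stepKerPos_KSC_cinv_on`, ★★★ `stepKerPos_KSCU_on` (§3)
# (pub-ymgap N06 row 13: the (3.48) member of `B9SectBCodedReadingsU.SectBStepU`, G′ side, at the record's kernel `Cinv := CinvY`)

T. Bałaban, *Propagators for lattice gauge theories in a background field*, Commun. Math. Phys. **99** (1985) 389–434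
[`Balaban1985BackgroundPropagators`, "B9"]; [4] = T. Bałaban, *Propagators and renormalization transformations for lattice gauge
theories. II*, Commun. Math. Phys. **96** (1984) 223–250 [`Balaban1984PropagatorsII`].

statement-level skeleton of published theorems with citation tags; proofs where landed; nothing here is a claim about the
Yang–Mills mass gap

THE PRINTED LOCI.  Theorem 3.2 (3.48) p. 398 (*«|(Q′G′²Q′*)⁻¹(U; y, y′)| ≦ B₁(Lʲη)⁻⁴(L^{j′}η)^{−d}e^{−δd(y,y′)}»* — here `d` of print = `d + 1` of the tree,
the space-time dimension); (3.19)–(3.21) pp. 393–394; (3.57)–(3.59) p. 402; p. 403 (*«The inverse satisfies Theorem 3.2»*); [4] (2.51) p. 232, (2.69) p. 235.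

WHAT.  For a subfamily `f : J → MemberY` of node00-def-Y's members, site transporters `par j`, a real basis `b` of `𝔸` (coordinate bound `M₂`) and block
labellings `ι_B j` (sections of `β`):
* §1 `kerCY x par U y y′ := sup_{|E| ≦ 1} ‖(CY par (GpY par) U)(δ_{βy′} ⊗ E)(βy)‖` — BY `rfl` the record's `B9.SiteKernel` reading `siteKernelOfOp … (CY …) β β`
  (`Node00.OpsYOfLetters`; `kerCY_eq`, `pullS_CinvY_ker`); `len_ιB`, ★ `cWtY_mul_len_pow` (`cWtY(s)·(L^{j(s)}η)^{d+1} = η⁻⁴`: the (3.48) reading weight against the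
  scale length); `norm_XinvY_deltaY_basis_le`; ★★ `hasMajorant_CopC_base` — READING: the record's bound `kerCY U ≦ B₁(Lʲη)⁻⁴(L^{j′}η)^{−(d+1)}e^{−δd}` gives the
  block majorant `|ι|·M₂Σ‖b‖·B₁·(Lʲη)⁻⁴e^{−δd}` of the letter `CopC (base U)` for the block map `ι_B ∘ fst` (r06's `B9Thm34InvBlk.hasMajorant_blk_of_entry_le`, fibre
  multiplicity `|ι|`); `XinvY_eq_smul_symm_CopC`, `blockSupp_coordEquiv_deltaY`; ★★ `kerCY_le_of_hasMajorant_CopC` — WRITING: a block majorant `B(Lʲη)⁻⁴e^{−δd}` of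
  `CopC V` bounds `kerCY (dec V) ≦ M₂Σ‖b‖·B·(Lʲη)⁻⁴(L^{j′}η)^{−(d+1)}e^{−δd}` (`len_label` ∕ `dist_label` move the reading from `ι_B(βy)` to `y`).
* §2 the law `VarParY i par c_var β′ U a` ((3.58)∕(3.59): along every block contour the adjoint action of the transporter of `e^{iηa}U` differs from
  that of `U` by `≦ c_var·β′` in operator norm, both for `τ` and `τ⁻¹`), the tools `norm_R_sub_R_le` ∕ `norm_R_sub_R_le_of_var` (for its discharge),
  `QpY_sub_apply`, and ★ `hasMajorantHom_FcC` ∕ `hasMajorantHom_FcsC`: under the law the (3.57) letters `FcC ∕ FcsC (base U) (mult a)` are block-local with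
  `M₂Σ‖b‖·c_var·β′·𝟙[a = a′]` (field `hF`); §2b ★★ `varParY_of_cplxLettersY`: the law at `(C_q, β′)` from g7's `CplxLettersY` (its `kF ∕ sF` conjuncts) for
  transporter tables with `U(Γ_{z,w}) = U(Γ_{w,z})⁻¹`.
* §3 `CinvY f G par j` (the record's kernel family); ★★ `cinvFrame₃CodedOn` — `CinvFrame₃` over the coded carriers for g7's coded readings `KSC`, block carrier
  `BlkY × ι` ∕ `ι_B ∘ fst`, `dB := d + 1`, the letters of `B9SectBKerLettersY`, the family `pullS 𝔠 (CinvY j)`; root `gpFrame₂CodedOn` with `read342Y_KSC` ∕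
  `write342Y_KSC`; DISPLAYED beyond the root frame's data: `hunitX` (`(Q′G′²Q′*)(U)` is a unit at `G`-valued `U` — Thm 3.2 ∕ 3.11's regime; at the record
  `B9Thm311PosAtRecordV4.isUnit_XY_parSymY`) and the reversal law `hsym` (`U(Γ_{z,w}) = U(Γ_{w,z})⁻¹`; at the record `Node00.parSymY_inv_symm`) — the
  variation law itself is DISCHARGED from g7's `hC37` by §2b ★★ `varParY_of_cplxLettersY`; ★★ `stepKerPos_KSC_cinv_on` (`stepKerPos_of_cinvFrame₃`); ★★★ `stepKerPos_KSCU_on` —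
  `StepKerPos (d+1) c35 (geo9Y∘f) (codingYx…).bg (KSCU∘f) (KACU∘f) (pullS 𝔠 (CinvY j)) (pullS 𝔠 (CinvY j))`, THE (3.48) MEMBER OF `SectBStepU` at `Cinv := CinvY`
  (input transfer `hin_KSCU_on_pos`, identity output).

HONEST FRAMING.  r06's uniform clauses (`thm34_Gp_uniform` R1, `thm34_Cinv_uniform_blk`) do the analysis; this file is their instance at def-Y's letters plus
two dictionaries.  DISPLAYED beyond the root frame's binders: the invertibility `hunitX` (a theorem at the record's `parSymY` for the matrix algebra —
`B9Thm311PosAtRecordV4.isUnit_XY_parSymY` — not re-proved here for a general `𝔸`, `par`) and the reversal law `hsym` (definitional for `parSymY`); the (3.59)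
variation law `VarParY` is NOT displayed: it follows from g7's `hC37` (`varParY_of_cplxLettersY`).  Count-neutral; no summit ∕ sub-problem statement is proved; N06 is not discharged by this file; nothing continuum ∕ OS ∕ mass-gap ∕
Clay.  No `sorry`, no `axiom`, no `… : Prop` fact beyond the displayed law `VarParY` (a definition with parameters), no `instance`, no `notation`.
Seat dag-n06-c g12, 2026-08-28; `--supports stmt-QuantumFields-27364`.

RELATED IN THE TREE, NOT DUPLICATED.  `B9SectBKerFrameV3` (the frame), `B9SectBKerLettersY` (the letters), `B9SectBKerStepRecordReduction` (g11: the OLD-reader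
record step reduced to the coded `KSC` step — superseded under R13-U1 by `stepKerPos_KSCU_on` here, same transfer pattern), `B9SectBStepsKSCU` (`hin_KSCU_on_pos`),
pv `B9Thm39CinvSandwichQ` ∕ r03 `B9Thm39ReadingAtLetters` (`CY_deltaY_apply`), dag-n06 `B9Ineq349SiteComposite` (`cWtY_mul_W`), g7 `B9SectBGpReadingsY`
(`len_label`, `dist_label`, `etaS_eq_eta`).
-/

noncomputable section

namespace Literature.MathematicalPhysics.QuantumFieldTheory.Balaban1983to89.B9SectBKerFrameCodedY

open Literature.MathematicalPhysics.QuantumFieldTheory.Balaban1983to89.B6RandomWalk (HasMajorant BlockSupp hasMajorant_mono)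
open Literature.MathematicalPhysics.QuantumFieldTheory.Balaban1983to89.B6RandomWalkHom (HasMajorantHom hasMajorantHom_mono)
open Literature.MathematicalPhysics.QuantumFieldTheory.Balaban1983to89.B9Thm34Ext (toB6)
open Literature.MathematicalPhysics.QuantumFieldTheory.Balaban1983to89.B9Thm34Inv (entry)
open Literature.MathematicalPhysics.QuantumFieldTheory.Balaban1983to89.B9Thm34InvBlk (hasMajorant_blk_of_entry_le)
open Literature.MathematicalPhysics.QuantumFieldTheory.Balaban1983to89.B9Eq39Adjoint (R fluct)
open Literature.MathematicalPhysics.QuantumFieldTheory.Balaban1983to89.B9Eq352DivFormLetters (conj conj_apply coordEquiv coordEquiv_apply coordEquiv_symm_apply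
  norm_coordSymm_apply_le)
open Literature.MathematicalPhysics.QuantumFieldTheory.Balaban1983to89.B6KLevelCensusIndexV1 (KIdx kGeo)
open Literature.MathematicalPhysics.QuantumFieldTheory.Balaban1983to89.B6Ineq2142KLevelV1 (β beta_level lvl)
open Literature.MathematicalPhysics.QuantumFieldTheory.Balaban1983to89.B6Ineq268MultiLevelBox (W W_eq W_pos)
open Literature.MathematicalPhysics.QuantumFieldTheory.Balaban1983to89.B9SectBCodedCarrier (CCfg pullS)
open Literature.MathematicalPhysics.QuantumFieldTheory.Balaban1983to89.B9Eq360DeltaPrimeAY (AfldY blkY blkY_apply mulY kFY kQY sFY sQY Rclm Rclm_apply)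
open Literature.MathematicalPhysics.QuantumFieldTheory.Balaban1983to89.B9PinMembersKLevelV1 (MemberY geo9Y bg9Y)
open Literature.MathematicalPhysics.QuantumFieldTheory.Balaban1983to89.B9SectBGpLettersY (decY decY_base GVal blkC GopC norm_le_one_and_inv_of_mem kFC sFC wC)
open Literature.MathematicalPhysics.QuantumFieldTheory.Balaban1983to89.B9Thm311ReadingAtLetters (wB wB_pos)
open Literature.MathematicalPhysics.QuantumFieldTheory.Balaban1983to89.B9SectBGpFrameCodedY (codingYx CplxLettersY)
open Literature.MathematicalPhysics.QuantumFieldTheory.Balaban1983to89.B9SectBCodedChainOnSubfamily (gpFrame₂CodedOn)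
open Literature.MathematicalPhysics.QuantumFieldTheory.Balaban1983to89.B9SectBGpReadingsY (read342Y_KSC write342Y_KSC)
open Literature.MathematicalPhysics.QuantumFieldTheory.Balaban1983to89.B9SectBCodedReadingsU (KSCU KACU)
open Literature.MathematicalPhysics.QuantumFieldTheory.Balaban1983to89.B9SectBStepsKSCU (hin_KSCU_on_pos)
open Literature.MathematicalPhysics.QuantumFieldTheory.Balaban1983to89.B9SectBStepPosFamilyTransfer (stepKerPos_of_family_pos)
open Literature.MathematicalPhysics.QuantumFieldTheory.Balaban1983to89.B9SectBStepWhole (StepKerPos)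
open Literature.MathematicalPhysics.QuantumFieldTheory.Balaban1983to89.B9SectBKerFrameV3 (CinvFrame₃ stepKerPos_of_cinvFrame₃)
open Literature.MathematicalPhysics.QuantumFieldTheory.Balaban1983to89.B9SectBGpReadingsY (KSC etaS_eq_eta len_label dist_label)
open Literature.MathematicalPhysics.QuantumFieldTheory.Balaban1983to89.B9Ineq349SiteComposite (cWtY_mul_W cWtY_pos)
open Literature.MathematicalPhysics.QuantumFieldTheory.Balaban1983to89.B9GeoLemma21KLevelV1 (geo9Y_len_pos geo9K_eta_pos)
open Literature.MathematicalPhysics.QuantumFieldTheory.Balaban1983to89.B9Thm39ReadingAtLetters (CY_deltaY_apply)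
open Literature.MathematicalPhysics.QuantumFieldTheory.Balaban1983to89.B9SectBKerLettersY (QcC QcsC CopC FcC FcsC entry_CopC norm_apply_deltaY_basis_le
  bddAbove_norm_apply_deltaY copC_eq XC_mul_CopC qcC_prod qcsC_prod hasMajorantHom_QcC_base hasMajorantHom_QcsC_base)
open Literature.MathematicalPhysics.QuantumFieldTheory.Balaban1983to89.B9Thm39CinvSandwichQ (sum_abs_qpK_le_one QpY_apply_eq_zero_of QpsY_apply)
open Literature.MathematicalPhysics.QuantumFieldTheory.Balaban1983to89.B9Eq3104CutoffCommutatorSizes (qpK_ne_zero_imp)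
open Literature.MathematicalPhysics.QuantumFieldTheory.Balaban1983to89.B9Eq376POneLetters (conjHom conjHom_apply)
open Literature.MathematicalPhysics.QuantumFieldTheory.Balaban1983to89.B9GeoNormsKLevelV1 (geo9K)
open Literature.MathematicalPhysics.QuantumFieldTheory.Balaban1983to89.Node00 (SiteY BlkY IBondY CfgY BallY SiteParY BondOpY BondParY GpY QpY QpsY XY XinvY CY
  cWtY etaS deltaY siteKernelOfOp qpK qpT blkCornerY trLiftY trLiftY_apply deltaPrimeAY)

variable {d ℓ : ℕ} {hd : 1 ≤ d + 1} {hL : Odd (ℓ + 1) ∧ 1 < ℓ + 1} {b₀ b₁ : ℝ} {Mstar : ℕ}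
variable {𝔸 : Type} [NormedRing 𝔸] [NormedAlgebra ℂ 𝔸] [CompleteSpace 𝔸]

/-! ## §1 The (3.48) kernel of the record READ ∕ WRITTEN against block majorants of `CopC` -/

section Kernel

variable (x : MemberY d ℓ hd hL b₀ b₁ Mstar) (par : SiteParY 𝔸 x.toKIdx) {ι : Type} [Fintype ι] (b : Module.Basis ι ℝ 𝔸)
  (ιB : BlkY x.toKIdx → IBondY x.toKIdx) {Rr : ℝ} {Hp : Prop}

omit [NormedRing 𝔸] [NormedAlgebra ℂ 𝔸] [CompleteSpace 𝔸] in
/-- the scale length of a labelled block: `(Lʲη)` with `j` the block's level. [cite: Balaban1985BackgroundPropagators, (3.41) p.397, bookkeeping] -/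
theorem len_ιB (hι : ∀ s : BlkY x.toKIdx, β x.toKIdx.hN x.toKIdx.D x.toKIdx.hk (ιB s) = s) (s : BlkY x.toKIdx) :
    (geo9Y x).len (ιB s) = (((ℓ + 1 : ℕ) : ℝ)) ^ s.1.1 * etaS x.toKIdx := by
  have hk1 : 1 ≤ x.k := le_trans one_le_two x.hk2
  show (kGeo x.toKIdx).len (ιB s) = _
  rw [B6KLevelCensusIndexV1.len_eq, ← beta_level x.toKIdx.hN x.toKIdx.D x.toKIdx.hk hk1, etaS_eq_eta, div_eq_mul_inv, hι]

omit [NormedRing 𝔸] [NormedAlgebra ℂ 𝔸] [CompleteSpace 𝔸] in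
/-- ★ **THE (3.48) WEIGHT IN PRINT's UNITS**: `cWtY(s)·(L^{j(s)}η)^{d+1} = η⁻⁴` — the reading weight `η^{−4−(d+1)}/W_s` against the scale length of the block.
[cite: Balaban1985BackgroundPropagators, (3.48) p.398; Balaban1984PropagatorsII, (2.69) p.235, bookkeeping] -/
theorem cWtY_mul_len_pow (hι : ∀ s : BlkY x.toKIdx, β x.toKIdx.hN x.toKIdx.D x.toKIdx.hk (ιB s) = s) (s : BlkY x.toKIdx) :
    cWtY x.toKIdx s * (geo9Y x).len (ιB s) ^ (d + 1) = ((kGeo x.toKIdx).eta ^ 4)⁻¹ := by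
  have hη : 0 < etaS x.toKIdx := by rw [etaS_eq_eta]; exact geo9K_eta_pos x.toKIdx
  have hW : W x.toKIdx.D.toDomains s = ((((ℓ + 1 : ℕ) : ℝ)) ^ s.1.1) ^ (d + 1) := by rw [W_eq]; push_cast; ring
  rw [len_ιB x ιB hι, mul_pow, ← hW, ← mul_assoc, cWtY_mul_W, ← etaS_eq_eta, inv_pow, pow_add, mul_inv, mul_assoc,
    inv_mul_cancel₀ (pow_ne_zero _ hη.ne'), mul_one]

/-- **THE RECORD's (3.48) KERNEL OF THE LETTER `C(U)` AT THE CARRIER BLOCKS**: `sup_{|E| ≦ 1} ‖(C(U)(δ_{β y′} ⊗ E))(β y)‖` — the `B9.SiteKernel` reading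
`siteKernelOfOp … (CY par (GpY par)) β β` of the record (`OpsYOfLetters`), by `rfl` (`kerCY_eq`). [cite: Balaban1985BackgroundPropagators, (3.48) p.398] -/
def kerCY (U : CfgY 𝔸 x.toKIdx) (y y' : IBondY x.toKIdx) : ℝ :=
  ⨆ E : BallY 𝔸, ‖CY x.toKIdx par (GpY x.toKIdx par) U (deltaY (β x.toKIdx.hN x.toKIdx.D x.toKIdx.hk y') (E : 𝔸)) (β x.toKIdx.hN x.toKIdx.D x.toKIdx.hk y)‖

/-- the record's two-point kernel IS `kerCY`. [cite: Balaban1985BackgroundPropagators, (3.48) p.398, bookkeeping] -/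
theorem kerCY_eq (G : Subgroup 𝔸ˣ) (U : CfgY 𝔸 x.toKIdx) (y y' : IBondY x.toKIdx) :
    (siteKernelOfOp x.toKIdx (bg9Y 𝔸 G x) (fun U => U) (CY x.toKIdx par (GpY x.toKIdx par))
        (β x.toKIdx.hN x.toKIdx.D x.toKIdx.hk) (β x.toKIdx.hN x.toKIdx.D x.toKIdx.hk)).ker U y y' = kerCY x par U y y' := rfl

/-- `0 ≦ kerCY`. [cite: Balaban1985BackgroundPropagators, (3.48) p.398, bookkeeping] -/
theorem kerCY_nonneg (U : CfgY 𝔸 x.toKIdx) (y y' : IBondY x.toKIdx) : 0 ≤ kerCY x par U y y' :=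
  Real.iSup_nonneg fun _ => norm_nonneg _

/-- the letter `XinvY` on an `𝔸`-valued delta, read through the (3.48) kernel: `‖XinvY(U)(δ_{s′} ⊗ b_j)(s)‖ ≦ ‖b_j‖·cWtY(s′)⁻¹·kerCY U (ι_B s) (ι_B s′)`.
[cite: Balaban1985BackgroundPropagators, (3.48) p.398; Balaban1984PropagatorsII, (2.51) p.232] -/
theorem norm_XinvY_deltaY_basis_le (hι : ∀ s : BlkY x.toKIdx, β x.toKIdx.hN x.toKIdx.D x.toKIdx.hk (ιB s) = s) {M₂ : ℝ} (hM₂ : 0 ≤ M₂)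
    (hrepr : ∀ (v : 𝔸) (j : ι), |b.repr v j| ≤ M₂ * ‖v‖) (U : CfgY 𝔸 x.toKIdx) (s s' : BlkY x.toKIdx) (j : ι) :
    ‖XinvY x.toKIdx par (GpY x.toKIdx par) U (deltaY s' (b j)) s‖ ≤ ‖b j‖ * ((cWtY x.toKIdx s')⁻¹ * kerCY x par U (ιB s) (ιB s')) := by
  have hw := cWtY_pos x.toKIdx s'
  haveI : Nonempty (BallY 𝔸) := ⟨⟨0, by simp⟩⟩
  have hbddC := bddAbove_norm_apply_deltaY b (CY x.toKIdx par (GpY x.toKIdx par) U) hM₂ hrepr s' s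
  have hker : kerCY x par U (ιB s) (ιB s') = ⨆ E : BallY 𝔸, ‖CY x.toKIdx par (GpY x.toKIdx par) U (deltaY s' (E : 𝔸)) s‖ := by
    simp only [kerCY, hι]
  have hpt : ∀ E : BallY 𝔸, ‖XinvY x.toKIdx par (GpY x.toKIdx par) U (deltaY s' (E : 𝔸)) s‖ ≤ (cWtY x.toKIdx s')⁻¹ * kerCY x par U (ιB s) (ιB s') := by
    intro E
    have hC : ‖CY x.toKIdx par (GpY x.toKIdx par) U (deltaY s' (E : 𝔸)) s‖ =
        cWtY x.toKIdx s' * ‖XinvY x.toKIdx par (GpY x.toKIdx par) U (deltaY s' (E : 𝔸)) s‖ := by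
      rw [CY_deltaY_apply, norm_smul, Complex.norm_real, Real.norm_eq_abs, abs_of_pos hw]
    have hX : ‖XinvY x.toKIdx par (GpY x.toKIdx par) U (deltaY s' (E : 𝔸)) s‖ =
        (cWtY x.toKIdx s')⁻¹ * ‖CY x.toKIdx par (GpY x.toKIdx par) U (deltaY s' (E : 𝔸)) s‖ := by
      rw [hC, ← mul_assoc, inv_mul_cancel₀ hw.ne', one_mul]
    rw [hX, hker]
    exact mul_le_mul_of_nonneg_left (le_ciSup hbddC E) (inv_nonneg.2 hw.le)
  have hsup : (⨆ E : BallY 𝔸, ‖XinvY x.toKIdx par (GpY x.toKIdx par) U (deltaY s' (E : 𝔸)) s‖) ≤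
      (cWtY x.toKIdx s')⁻¹ * kerCY x par U (ιB s) (ιB s') := ciSup_le hpt
  exact (norm_apply_deltaY_basis_le b (XinvY x.toKIdx par (GpY x.toKIdx par) U) hM₂ hrepr s' s j).trans
    (mul_le_mul_of_nonneg_left hsup (norm_nonneg _))

/-- ★★ **READING (3.48)** (field `readKer` at the letters): the record's kernel bound `kerCY U y y′ ≦ B₁(Lʲη)⁻⁴(L^{j′}η)^{−(d+1)}e^{−δd(y,y′)}` gives the BLOCK MAJORANT
`|ι|·M₂Σ_j‖b_j‖·B₁·(Lʲη)⁻⁴e^{−δd}` of `CopC (base U)` for the block map `ι_B ∘ fst` (entrywise reading through the basis deltas, the (3.48) weight `cWtY·(L^{j′}η)^{d+1} = η⁻⁴`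
cancelling the letter's `η⁻⁴`, then r06's `hasMajorant_blk_of_entry_le` with the displayed fibre multiplicity `|ι|`).
[cite: Balaban1985BackgroundPropagators, Thm 3.2 (3.48) p.398, (3.8) p.392; Balaban1984PropagatorsII, (2.51) p.232, (2.69) p.235] -/
theorem hasMajorant_CopC_base [Fintype (geo9Y x).Site] [DecidableEq ι] (hι : ∀ s : BlkY x.toKIdx, β x.toKIdx.hN x.toKIdx.D x.toKIdx.hk (ιB s) = s)
    {M₂ : ℝ} (hM₂ : 0 ≤ M₂) (hrepr : ∀ (v : 𝔸) (j : ι), |b.repr v j| ≤ M₂ * ‖v‖) (U : CfgY 𝔸 x.toKIdx) {B₁ δ : ℝ} (hB₁ : 0 ≤ B₁)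
    (hker : ∀ y y' : IBondY x.toKIdx, kerCY x par U y y' ≤
      B₁ * (geo9Y x).len y ^ (-(4 : ℝ)) * (geo9Y x).len y' ^ (-(((d + 1 : ℕ)) : ℝ)) * Real.exp (-(δ * (geo9Y x).dist y y'))) :
    HasMajorant (g := toB6 (geo9Y x) Rr Hp) (fun q : BlkY x.toKIdx × ι => ιB q.1) (CopC x.toKIdx par b (.base U))
      (fun a a' => (Fintype.card ι : ℝ) * (M₂ * ∑ j, ‖b j‖) * B₁ * (geo9Y x).len a ^ (-(4 : ℝ)) * Real.exp (-(δ * (geo9Y x).dist a a'))) := by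
  classical
  have hSb : 0 ≤ ∑ j, ‖b j‖ := Finset.sum_nonneg fun j _ => norm_nonneg _
  have hη4 : 0 < (kGeo x.toKIdx).eta ^ 4 := pow_pos (geo9K_eta_pos x.toKIdx) 4
  have h := hasMajorant_blk_of_entry_le (R := Rr) (H := Hp) (g := geo9Y x) (fun q : BlkY x.toKIdx × ι => ιB q.1)
    (T := CopC x.toKIdx par b (.base U))
    (K := fun a a' => (M₂ * ∑ j, ‖b j‖) * B₁ * (geo9Y x).len a ^ (-(4 : ℝ)) * Real.exp (-(δ * (geo9Y x).dist a a')))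
    (Fintype.card ι) (fun a a' => by
      have := geo9Y_len_pos x a
      positivity) (fun y' => by
      -- the fibres of `ι_B ∘ fst` have at most `|ι|` points (the labelling is injective)
      have hinj : Function.Injective ιB := fun s t h => by rw [← hι s, ← hι t, h]
      rw [← Finset.card_univ (α := ι)]
      refine Finset.card_le_card_of_injOn (fun q => q.2) (fun _ _ => Finset.mem_coe.2 (Finset.mem_univ _)) fun q hq q' hq' h => ?_
      have h1 : ιB q.1 = y' := (Finset.mem_filter.1 (Finset.mem_coe.1 hq)).2
      have h2 : ιB q'.1 = y' := (Finset.mem_filter.1 (Finset.mem_coe.1 hq')).2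
      exact Prod.ext (hinj (h1.trans h2.symm)) h) fun q q' => ?_
  · exact hasMajorant_mono (g := toB6 (geo9Y x) Rr Hp) _ h fun a a' => le_of_eq (by ring)
  -- one entry
  rw [entry_CopC, decY_base]
  have hX := norm_XinvY_deltaY_basis_le x par b ιB hι hM₂ hrepr U q.1 q'.1 q'.2
  have hk := hker (ιB q.1) (ιB q'.1)
  have hw0 : 0 ≤ (cWtY x.toKIdx q'.1)⁻¹ := inv_nonneg.2 (cWtY_pos x.toKIdx q'.1).le
  have hw : (cWtY x.toKIdx q'.1)⁻¹ * (geo9Y x).len (ιB q'.1) ^ (-(((d + 1 : ℕ)) : ℝ)) = (kGeo x.toKIdx).eta ^ 4 := by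
    rw [Real.rpow_neg (geo9Y_len_pos x _).le, Real.rpow_natCast, ← mul_inv, cWtY_mul_len_pow x ιB hι, inv_inv]
  have hbj : ‖b q'.2‖ ≤ ∑ j, ‖b j‖ := Finset.single_le_sum (f := fun j => ‖b j‖) (fun j _ => norm_nonneg (b j)) (Finset.mem_univ q'.2)
  have hexp : 0 ≤ B₁ * (geo9Y x).len (ιB q.1) ^ (-(4 : ℝ)) * Real.exp (-(δ * (geo9Y x).dist (ιB q.1) (ιB q'.1))) := by
    have := geo9Y_len_pos x (ιB q.1)
    positivity
  calc |((kGeo x.toKIdx).eta ^ 4)⁻¹ * b.repr (XinvY x.toKIdx par (GpY x.toKIdx par) U (deltaY q'.1 (b q'.2)) q.1) q.2|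
      = ((kGeo x.toKIdx).eta ^ 4)⁻¹ * |b.repr (XinvY x.toKIdx par (GpY x.toKIdx par) U (deltaY q'.1 (b q'.2)) q.1) q.2| := by
        rw [abs_mul, abs_of_pos (inv_pos.2 hη4)]
    _ ≤ ((kGeo x.toKIdx).eta ^ 4)⁻¹ * (M₂ * (‖b q'.2‖ * ((cWtY x.toKIdx q'.1)⁻¹ *
          (B₁ * (geo9Y x).len (ιB q.1) ^ (-(4 : ℝ)) * (geo9Y x).len (ιB q'.1) ^ (-(((d + 1 : ℕ)) : ℝ)) *
            Real.exp (-(δ * (geo9Y x).dist (ιB q.1) (ιB q'.1))))))) := by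
        refine mul_le_mul_of_nonneg_left ((hrepr _ _).trans (mul_le_mul_of_nonneg_left ?_ hM₂)) (inv_pos.2 hη4).le
        exact hX.trans (mul_le_mul_of_nonneg_left (mul_le_mul_of_nonneg_left hk hw0) (norm_nonneg _))
    _ = (M₂ * ‖b q'.2‖) * (B₁ * (geo9Y x).len (ιB q.1) ^ (-(4 : ℝ)) * Real.exp (-(δ * (geo9Y x).dist (ιB q.1) (ιB q'.1)))) *
          (((kGeo x.toKIdx).eta ^ 4)⁻¹ * ((cWtY x.toKIdx q'.1)⁻¹ * (geo9Y x).len (ιB q'.1) ^ (-(((d + 1 : ℕ)) : ℝ)))) := by ring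
    _ = (M₂ * ‖b q'.2‖) * (B₁ * (geo9Y x).len (ιB q.1) ^ (-(4 : ℝ)) * Real.exp (-(δ * (geo9Y x).dist (ιB q.1) (ιB q'.1)))) := by
        rw [hw, inv_mul_cancel₀ hη4.ne', mul_one]
    _ ≤ (M₂ * ∑ j, ‖b j‖) * (B₁ * (geo9Y x).len (ιB q.1) ^ (-(4 : ℝ)) * Real.exp (-(δ * (geo9Y x).dist (ιB q.1) (ιB q'.1)))) :=
        mul_le_mul_of_nonneg_right (mul_le_mul_of_nonneg_left hbj hM₂) hexp
    _ = (M₂ * ∑ j, ‖b j‖) * B₁ * (geo9Y x).len (ιB q.1) ^ (-(4 : ℝ)) * Real.exp (-(δ * (geo9Y x).dist (ιB q.1) (ιB q'.1))) := by ring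

/-- the letter `XinvY` recovered from `CopC`: `XinvY(dec V) f = η⁴·coord⁻¹(CopC V (coord f))`. [cite: Balaban1985BackgroundPropagators, (3.21) p.394, bookkeeping] -/
theorem XinvY_eq_smul_symm_CopC (c : CCfg (CfgY 𝔸 x.toKIdx) (AfldY 𝔸 x.toKIdx)) (f : BlkY x.toKIdx → 𝔸) :
    XinvY x.toKIdx par (GpY x.toKIdx par) (decY x.toKIdx c) f = ((kGeo x.toKIdx).eta ^ 4) • (coordEquiv b).symm (CopC x.toKIdx par b c (coordEquiv b f)) := by
  have hη4 : (kGeo x.toKIdx).eta ^ 4 ≠ 0 := pow_ne_zero 4 (geo9K_eta_pos x.toKIdx).ne'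
  have key : (coordEquiv b).symm (CopC x.toKIdx par b c (coordEquiv b f)) =
      ((kGeo x.toKIdx).eta ^ 4)⁻¹ • XinvY x.toKIdx par (GpY x.toKIdx par) (decY x.toKIdx c) f := by
    rw [CopC, B9Eq352DivFormLetters.conj, LinearEquiv.conj_apply_apply, LinearEquiv.symm_apply_apply, LinearEquiv.symm_apply_apply,
      LinearMap.smul_apply, LinearMap.restrictScalars_apply]
  rw [key, smul_smul, mul_inv_cancel₀ hη4, one_smul]

omit [CompleteSpace 𝔸] in
/-- the coordinates of an `𝔸`-valued delta are supported in the block of its point, with bound `M₂‖E‖`. [cite: Balaban1984PropagatorsII, (2.51) p.232, bookkeeping] -/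
theorem blockSupp_coordEquiv_deltaY [Fintype (geo9Y x).Site] {M₂ : ℝ} (hM₂ : 0 ≤ M₂) (hrepr : ∀ (v : 𝔸) (j : ι), |b.repr v j| ≤ M₂ * ‖v‖)
    (s' : BlkY x.toKIdx) {E : 𝔸} (hE : ‖E‖ ≤ 1) :
    BlockSupp (g := toB6 (geo9Y x) Rr Hp) (fun q : BlkY x.toKIdx × ι => ιB q.1) (coordEquiv b (deltaY s' E)) (ιB s') M₂ := by
  refine ⟨hM₂, fun q _ => ?_, fun q hq => ?_⟩
  · rw [coordEquiv_apply]
    refine (hrepr _ _).trans (mul_le_of_le_one_right hM₂ ?_)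
    simp only [deltaY]
    split_ifs
    · exact hE
    · rw [norm_zero]; exact zero_le_one
  · rw [coordEquiv_apply]
    have hne : q.1 ≠ s' := fun h => hq (by rw [h])
    simp only [deltaY, if_neg hne, map_zero, Finsupp.zero_apply]

/-- ★★ **WRITING (3.48)** (field `writeKer` at the letters): a block majorant `B·(Lʲη)⁻⁴e^{−δd}` of `CopC V` for `ι_B ∘ fst` bounds the record's kernel of `C(dec V)` at the
carrier blocks: `kerCY (dec V) y y′ ≦ M₂Σ_j‖b_j‖·B·(Lʲη)⁻⁴(L^{j′}η)^{−(d+1)}e^{−δd(y,y′)}` (the coordinates of `δ_{β y′} ⊗ E` are block-supported with bound `M₂`, the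
majorant bounds `CopC` on them, the synthesis bound gives `XinvY = η⁴·coord⁻¹ ∘ CopC ∘ coord`, and `cWtY(β y′)·η⁴ = (L^{j′}η)^{−(d+1)}`).
[cite: Balaban1985BackgroundPropagators, Thm 3.2 (3.48) p.398, p.403; Balaban1984PropagatorsII, (2.51) p.232, (2.69) p.235] -/
theorem kerCY_le_of_hasMajorant_CopC [Fintype (geo9Y x).Site] (hι : ∀ s : BlkY x.toKIdx, β x.toKIdx.hN x.toKIdx.D x.toKIdx.hk (ιB s) = s)
    {M₂ : ℝ} (hM₂ : 0 ≤ M₂) (hrepr : ∀ (v : 𝔸) (j : ι), |b.repr v j| ≤ M₂ * ‖v‖) (c : CCfg (CfgY 𝔸 x.toKIdx) (AfldY 𝔸 x.toKIdx)) {B δ : ℝ}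
    (hmaj : HasMajorant (g := toB6 (geo9Y x) Rr Hp) (fun q : BlkY x.toKIdx × ι => ιB q.1) (CopC x.toKIdx par b c)
      (fun a a' => B * (geo9Y x).len a ^ (-(4 : ℝ)) * Real.exp (-(δ * (geo9Y x).dist a a')))) (y y' : IBondY x.toKIdx) :
    kerCY x par (decY x.toKIdx c) y y' ≤
      (M₂ * ∑ j, ‖b j‖) * B * (geo9Y x).len y ^ (-(4 : ℝ)) * (geo9Y x).len y' ^ (-(((d + 1 : ℕ)) : ℝ)) * Real.exp (-(δ * (geo9Y x).dist y y')) := by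
  classical
  haveI : Nonempty (BallY 𝔸) := ⟨⟨0, by simp⟩⟩
  have hSb : 0 ≤ ∑ j, ‖b j‖ := Finset.sum_nonneg fun j _ => norm_nonneg _
  have hη4 : 0 < (kGeo x.toKIdx).eta ^ 4 := pow_pos (geo9K_eta_pos x.toKIdx) 4
  set s : BlkY x.toKIdx := β x.toKIdx.hN x.toKIdx.D x.toKIdx.hk y with hs
  set s' : BlkY x.toKIdx := β x.toKIdx.hN x.toKIdx.D x.toKIdx.hk y' with hs'
  have hly : (geo9Y x).len (ιB s) = (geo9Y x).len y := by rw [hs]; exact len_label x ιB hι y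
  have hly' : (geo9Y x).len (ιB s') = (geo9Y x).len y' := by rw [hs']; exact len_label x ιB hι y'
  have hdy : (geo9Y x).dist (ιB s) (ιB s') = (geo9Y x).dist y y' := by rw [hs, hs']; exact dist_label x ιB hι y y'
  have hw : cWtY x.toKIdx s' * (kGeo x.toKIdx).eta ^ 4 = (geo9Y x).len y' ^ (-(((d + 1 : ℕ)) : ℝ)) := by
    have hL : 0 < (geo9Y x).len (ιB s') ^ (d + 1) := pow_pos (geo9Y_len_pos x _) _
    have h2 : cWtY x.toKIdx s' = ((kGeo x.toKIdx).eta ^ 4)⁻¹ / (geo9Y x).len (ιB s') ^ (d + 1) := by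
      rw [eq_div_iff hL.ne', cWtY_mul_len_pow x ιB hι]
    rw [Real.rpow_neg (geo9Y_len_pos x _).le, Real.rpow_natCast, ← hly', h2, div_mul_eq_mul_div, inv_mul_cancel₀ hη4.ne', one_div]
  refine ciSup_le fun E => ?_
  have hE : ‖(E : 𝔸)‖ ≤ 1 := mem_closedBall_zero_iff.1 E.2
  have hsupp := blockSupp_coordEquiv_deltaY x b ιB (Rr := Rr) (Hp := Hp) hM₂ hrepr s' hE
  have hq : ∀ j : ι, |CopC x.toKIdx par b c (coordEquiv b (deltaY s' (E : 𝔸))) (s, j)| ≤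
      B * (geo9Y x).len (ιB s) ^ (-(4 : ℝ)) * Real.exp (-(δ * (geo9Y x).dist (ιB s) (ιB s'))) * M₂ := fun j =>
    hmaj (ιB s') _ M₂ hsupp (s, j)
  have hsymm : ‖(coordEquiv b).symm (CopC x.toKIdx par b c (coordEquiv b (deltaY s' (E : 𝔸)))) s‖ ≤
      (∑ j, ‖b j‖) * (B * (geo9Y x).len (ιB s) ^ (-(4 : ℝ)) * Real.exp (-(δ * (geo9Y x).dist (ιB s) (ιB s'))) * M₂) :=
    norm_coordSymm_apply_le b _ s _ hq
  have hX : ‖XinvY x.toKIdx par (GpY x.toKIdx par) (decY x.toKIdx c) (deltaY s' (E : 𝔸)) s‖ ≤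
      (kGeo x.toKIdx).eta ^ 4 * ((∑ j, ‖b j‖) * (B * (geo9Y x).len (ιB s) ^ (-(4 : ℝ)) * Real.exp (-(δ * (geo9Y x).dist (ιB s) (ιB s'))) * M₂)) := by
    rw [XinvY_eq_smul_symm_CopC x par b c, Pi.smul_apply, norm_smul, Real.norm_eq_abs, abs_of_pos hη4]
    exact mul_le_mul_of_nonneg_left hsymm hη4.le
  calc ‖CY x.toKIdx par (GpY x.toKIdx par) (decY x.toKIdx c) (deltaY s' (E : 𝔸)) s‖
      = cWtY x.toKIdx s' * ‖XinvY x.toKIdx par (GpY x.toKIdx par) (decY x.toKIdx c) (deltaY s' (E : 𝔸)) s‖ := by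
        rw [CY_deltaY_apply, norm_smul, Complex.norm_real, Real.norm_eq_abs, abs_of_pos (cWtY_pos x.toKIdx s')]
    _ ≤ cWtY x.toKIdx s' * ((kGeo x.toKIdx).eta ^ 4 * ((∑ j, ‖b j‖) *
          (B * (geo9Y x).len (ιB s) ^ (-(4 : ℝ)) * Real.exp (-(δ * (geo9Y x).dist (ιB s) (ιB s'))) * M₂))) :=
        mul_le_mul_of_nonneg_left hX (cWtY_pos x.toKIdx s').le
    _ = (M₂ * ∑ j, ‖b j‖) * B * (geo9Y x).len (ιB s) ^ (-(4 : ℝ)) * (cWtY x.toKIdx s' * (kGeo x.toKIdx).eta ^ 4) *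
          Real.exp (-(δ * (geo9Y x).dist (ιB s) (ιB s'))) := by ring
    _ = (M₂ * ∑ j, ‖b j‖) * B * (geo9Y x).len y ^ (-(4 : ℝ)) * (geo9Y x).len y' ^ (-(((d + 1 : ℕ)) : ℝ)) *
          Real.exp (-(δ * (geo9Y x).dist y y')) := by rw [hw, hly, hdy]

end Kernel

/-! ## §2 The (3.57)∕(3.59) variation letters under a DISPLAYED transporter-variation law -/

section Variation

variable (i : KIdx d ℓ hd hL b₀ b₁) (par : SiteParY 𝔸 i) {ι : Type} [Fintype ι] (b : Module.Basis ι ℝ 𝔸) (ιB : BlkY i → IBondY i) {Rr : ℝ} {Hp : Prop}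

/-- **THE DISPLAYED (3.58)∕(3.59) TRANSPORTER-VARIATION LAW** at a (base `U`, multiplier `a`) pair with constant `c_var` at exponent `β′`: along every block
contour the adjoint action of the transporter of the product `U′U = e^{iηa}·U` differs from that of `U` by `≦ c_var·β′` in operator norm, and so does the
adjoint action of the inverted transporters (print p. 402: *«|F′₂λ| ≦ O(1)α₁Q̃′|λ|»* from (3.37) summed along `|Γ_{y,x}| ≦ (d+1)Lʲ` bonds).  A named hypothesis of
§2's lemmas; DISCHARGED in §2b from g7's (3.37)-letters `CplxLettersY` (whose `kF ∕ sF` conjuncts are exactly these operator-norm bounds) for every transporter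
table with the reversal law; `norm_R_sub_R_le_of_var` is the alternative route from bounds on `τ′ − τ`, `τ′⁻¹ − τ⁻¹`. [cite: Balaban1985BackgroundPropagators, (3.57)–(3.59) p.402, (3.37) p.396] -/
def VarParY (cVar β' : ℝ) (U : CfgY 𝔸 i) (a : AfldY 𝔸 i) : Prop :=
  ∀ (s : BlkY i) (z : SiteY i), blkY i z = s → ∀ E : 𝔸,
    ‖R (qpT i par (decY i (.prod U a)) s z) E - R (qpT i par U s z) E‖ ≤ cVar * β' * ‖E‖ ∧
    ‖R (qpT i par (decY i (.prod U a)) s z)⁻¹ E - R (qpT i par U s z)⁻¹ E‖ ≤ cVar * β' * ‖E‖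

omit [NormedAlgebra ℂ 𝔸] [CompleteSpace 𝔸] in
/-- the adjoint action varied in the transporter: `R(u)E − R(v)E = (u − v)Eu⁻¹ + vE(u⁻¹ − v⁻¹)`, hence
`‖R(u)E − R(v)E‖ ≦ (‖u − v‖‖u⁻¹‖ + ‖v‖‖u⁻¹ − v⁻¹‖)‖E‖`. [cite: Balaban1985BackgroundPropagators, (3.58)–(3.59) p.402, bookkeeping] -/
theorem norm_R_sub_R_le (u v : 𝔸ˣ) (E : 𝔸) :
    ‖R u E - R v E‖ ≤ (‖(u : 𝔸) - v‖ * ‖((u⁻¹ : 𝔸ˣ) : 𝔸)‖ + ‖(v : 𝔸)‖ * ‖((u⁻¹ : 𝔸ˣ) : 𝔸) - ((v⁻¹ : 𝔸ˣ) : 𝔸)‖) * ‖E‖ := by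
  have h : R u E - R v E = ((u : 𝔸) - v) * E * ((u⁻¹ : 𝔸ˣ) : 𝔸) + (v : 𝔸) * E * (((u⁻¹ : 𝔸ˣ) : 𝔸) - ((v⁻¹ : 𝔸ˣ) : 𝔸)) := by
    simp only [R]; noncomm_ring
  rw [h]
  calc ‖((u : 𝔸) - v) * E * ((u⁻¹ : 𝔸ˣ) : 𝔸) + (v : 𝔸) * E * (((u⁻¹ : 𝔸ˣ) : 𝔸) - ((v⁻¹ : 𝔸ˣ) : 𝔸))‖
      ≤ ‖((u : 𝔸) - v) * E * ((u⁻¹ : 𝔸ˣ) : 𝔸)‖ + ‖(v : 𝔸) * E * (((u⁻¹ : 𝔸ˣ) : 𝔸) - ((v⁻¹ : 𝔸ˣ) : 𝔸))‖ := norm_add_le _ _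
    _ ≤ ‖(u : 𝔸) - v‖ * ‖E‖ * ‖((u⁻¹ : 𝔸ˣ) : 𝔸)‖ + ‖(v : 𝔸)‖ * ‖E‖ * ‖((u⁻¹ : 𝔸ˣ) : 𝔸) - ((v⁻¹ : 𝔸ˣ) : 𝔸)‖ :=
        add_le_add ((norm_mul_le _ _).trans (mul_le_mul_of_nonneg_right (norm_mul_le _ _) (norm_nonneg _)))
          ((norm_mul_le _ _).trans (mul_le_mul_of_nonneg_right (norm_mul_le _ _) (norm_nonneg _)))
    _ = (‖(u : 𝔸) - v‖ * ‖((u⁻¹ : 𝔸ˣ) : 𝔸)‖ + ‖(v : 𝔸)‖ * ‖((u⁻¹ : 𝔸ˣ) : 𝔸) - ((v⁻¹ : 𝔸ˣ) : 𝔸)‖) * ‖E‖ := by ring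

omit [NormedAlgebra ℂ 𝔸] [CompleteSpace 𝔸] in
/-- ★ the adjoint action varied in the transporter, SIZED: if `v` is contractive (`‖v‖, ‖v⁻¹‖ ≦ 1`) and `‖u − v‖, ‖u⁻¹ − v⁻¹‖ ≦ t` then
`‖R(u)E − R(v)E‖ ≦ t(2 + t)‖E‖`; the same for the inverted transporters. [cite: Balaban1985BackgroundPropagators, (3.58)–(3.59) p.402] -/
theorem norm_R_sub_R_le_of_var {u v : 𝔸ˣ} (hv : ‖(v : 𝔸)‖ ≤ 1 ∧ ‖((v⁻¹ : 𝔸ˣ) : 𝔸)‖ ≤ 1) {t : ℝ} (ht : 0 ≤ t)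
    (h1 : ‖(u : 𝔸) - v‖ ≤ t) (h2 : ‖((u⁻¹ : 𝔸ˣ) : 𝔸) - ((v⁻¹ : 𝔸ˣ) : 𝔸)‖ ≤ t) (E : 𝔸) :
    ‖R u E - R v E‖ ≤ t * (2 + t) * ‖E‖ ∧ ‖R u⁻¹ E - R v⁻¹ E‖ ≤ t * (2 + t) * ‖E‖ := by
  have hui : ‖((u⁻¹ : 𝔸ˣ) : 𝔸)‖ ≤ 1 + t := by
    have := norm_le_norm_add_norm_sub' ((u⁻¹ : 𝔸ˣ) : 𝔸) ((v⁻¹ : 𝔸ˣ) : 𝔸)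
    linarith [hv.2]
  have hu : ‖(u : 𝔸)‖ ≤ 1 + t := by
    have := norm_le_norm_add_norm_sub' (u : 𝔸) (v : 𝔸)
    linarith [hv.1]
  constructor
  · refine (norm_R_sub_R_le u v E).trans (mul_le_mul_of_nonneg_right ?_ (norm_nonneg _))
    nlinarith [mul_le_mul h1 hui (norm_nonneg _) ht, mul_le_mul hv.1 h2 (norm_nonneg _) zero_le_one, norm_nonneg ((u : 𝔸) - v)]
  · have h := norm_R_sub_R_le u⁻¹ v⁻¹ E
    rw [inv_inv, inv_inv] at h
    refine h.trans (mul_le_mul_of_nonneg_right ?_ (norm_nonneg _))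
    nlinarith [mul_le_mul h2 hu (norm_nonneg _) ht, mul_le_mul hv.2 h1 (norm_nonneg _) zero_le_one, norm_nonneg (((u⁻¹ : 𝔸ˣ) : 𝔸) - ((v⁻¹ : 𝔸ˣ) : 𝔸))]

/-- the (3.57) variation letter evaluated: `(Q′(U′U) − Q′(U))Λ(s) = Σ_z q′(s,z)·(R(τ′) − R(τ))Λ(z)`. [cite: Balaban1985BackgroundPropagators, (3.57)–(3.58) p.402, bookkeeping] -/
theorem QpY_sub_apply (U V : CfgY 𝔸 i) (Λ : SiteY i → 𝔸) (s : BlkY i) :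
    QpY i par V Λ s - QpY i par U Λ s = ∑ z, (((qpK i s z : ℝ)) : ℂ) • (R (qpT i par V s z) (Λ z) - R (qpT i par U s z) (Λ z)) := by
  rw [QpY, QpY, trLiftY_apply, trLiftY_apply, ← Finset.sum_sub_distrib]
  refine Finset.sum_congr rfl fun z _ => ?_
  rw [smul_sub]

/-- ★ FIELD `hF` (first half) at the letters: under the variation law at `(U, a)`, `FcC (base U) (mult a)` is BLOCK-LOCAL with the two-space majorant
`M₂Σ_j‖b_j‖·c_var·β′·𝟙[a = a′]`. [cite: Balaban1985BackgroundPropagators, (3.57) p.401, (3.59) p.402; Balaban1984PropagatorsII, (2.51) p.232] -/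
theorem hasMajorantHom_FcC [Fintype (geo9K i).Site] (hι : ∀ s : BlkY i, β i.hN i.D i.hk (ιB s) = s) {U : CfgY 𝔸 i} {a : AfldY 𝔸 i}
    {cVar β' : ℝ} (hcVar : 0 ≤ cVar) (hβ : 0 ≤ β') (hvar : VarParY i par cVar β' U a)
    {M₂ : ℝ} (hM₂ : 0 ≤ M₂) (hrepr : ∀ (v : 𝔸) (j : ι), |b.repr v j| ≤ M₂ * ‖v‖) :
    HasMajorantHom (g := toB6 (geo9K i) Rr Hp) (fun p : SiteY i × ι => blkC i ιB p.1) (fun q : BlkY i × ι => ιB q.1)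
      (FcC i par b (.base U) (.mult a)) (fun y y' : IBondY i => (M₂ * ∑ j, ‖b j‖) * cVar * β' * (if y = y' then (1 : ℝ) else 0)) := by
  classical
  have hinj : Function.Injective ιB := fun s t h => by rw [← hι s, ← hι t, h]
  have hSb : 0 ≤ ∑ j, ‖b j‖ := Finset.sum_nonneg fun j _ => norm_nonneg _
  set t : ℝ := cVar * β' with ht
  have ht0 : 0 ≤ t := mul_nonneg hcVar hβ
  intro y' μ B hμ q
  show |(QcC i par b (.prod U a) - QcC i par b (.base U)) μ q| ≤ _
  have hval : (QcC i par b (.prod U a) - QcC i par b (.base U)) μ q =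
      b.repr (QpY i par (decY i (.prod U a)) ((coordEquiv b).symm μ) q.1 - QpY i par U ((coordEquiv b).symm μ) q.1) q.2 := by
    rw [LinearMap.sub_apply, Pi.sub_apply, QcC, QcC, conjHom_apply, conjHom_apply, LinearMap.restrictScalars_apply, LinearMap.restrictScalars_apply,
      decY_base, map_sub, Finsupp.sub_apply]
  rw [hval]
  dsimp only
  set lam := (coordEquiv b).symm μ with hlam
  split_ifs with hq
  · have hbd : ∀ z, blkY i z = q.1 → ‖lam z‖ ≤ (∑ j, ‖b j‖) * B := fun z hz =>
      norm_coordSymm_apply_le b μ z B fun j => hμ.bound (z, j) (by show ιB (blkY i z) = y'; rw [hz, hq])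
    have hdiff : ‖QpY i par (decY i (.prod U a)) lam q.1 - QpY i par U lam q.1‖ ≤ t * ((∑ j, ‖b j‖) * B) := by
      rw [QpY_sub_apply]
      calc ‖∑ z, (((qpK i q.1 z : ℝ)) : ℂ) • (R (qpT i par (decY i (.prod U a)) q.1 z) (lam z) - R (qpT i par U q.1 z) (lam z))‖
          ≤ ∑ z, |qpK i q.1 z| * (t * ((∑ j, ‖b j‖) * B)) := (norm_sum_le _ _).trans (Finset.sum_le_sum fun z _ => by
            rw [norm_smul, Complex.norm_real, Real.norm_eq_abs]
            by_cases hqz : qpK i q.1 z = 0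
            · rw [hqz, abs_zero, zero_mul, zero_mul]
            · have hz := qpK_ne_zero_imp i hqz
              have hR := (hvar q.1 z hz (lam z)).1
              exact mul_le_mul_of_nonneg_left (hR.trans (mul_le_mul_of_nonneg_left (hbd z hz) ht0)) (abs_nonneg _))
        _ = (∑ z, |qpK i q.1 z|) * (t * ((∑ j, ‖b j‖) * B)) :=
            (Finset.sum_mul (s := Finset.univ) (f := fun z => |qpK i q.1 z|) (t * ((∑ j, ‖b j‖) * B))).symm
        _ ≤ 1 * (t * ((∑ j, ‖b j‖) * B)) :=
            mul_le_mul_of_nonneg_right (sum_abs_qpK_le_one i q.1) (by have := hμ.nonneg; positivity)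
        _ = t * ((∑ j, ‖b j‖) * B) := one_mul _
    calc |b.repr (QpY i par (decY i (.prod U a)) lam q.1 - QpY i par U lam q.1) q.2|
        ≤ M₂ * ‖QpY i par (decY i (.prod U a)) lam q.1 - QpY i par U lam q.1‖ := hrepr _ _
      _ ≤ M₂ * (t * ((∑ j, ‖b j‖) * B)) := mul_le_mul_of_nonneg_left hdiff hM₂
      _ = (M₂ * ∑ j, ‖b j‖) * cVar * β' * 1 * B := by rw [ht]; ring
  · have h0 : ∀ z, blkY i z = q.1 → lam z = 0 := fun z hz => by
      rw [hlam, coordEquiv_symm_apply]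
      refine Finset.sum_eq_zero fun j _ => ?_
      rw [hμ.off (z, j) (fun h => hq (by rw [← h]; show ιB q.1 = ιB (blkY i z); rw [hz])), zero_smul]
    rw [QpY_apply_eq_zero_of i par _ lam q.1 h0, QpY_apply_eq_zero_of i par _ lam q.1 h0, sub_zero, map_zero, Finsupp.zero_apply, abs_zero,
      mul_zero, zero_mul]

/-- ★ FIELD `hF` (second half) at the letters: under the same law `FcsC (base U) (mult a)` is BLOCK-LOCAL with the same two-space majorant from the block
carrier to the site carrier. [cite: Balaban1985BackgroundPropagators, (3.57) p.401, (3.59) p.402; Balaban1984PropagatorsII, (2.51) p.232] -/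
theorem hasMajorantHom_FcsC [Fintype (geo9K i).Site] {U : CfgY 𝔸 i} {a : AfldY 𝔸 i}
    {cVar β' : ℝ} (hcVar : 0 ≤ cVar) (hβ : 0 ≤ β') (hvar : VarParY i par cVar β' U a)
    {M₂ : ℝ} (hM₂ : 0 ≤ M₂) (hrepr : ∀ (v : 𝔸) (j : ι), |b.repr v j| ≤ M₂ * ‖v‖) :
    HasMajorantHom (g := toB6 (geo9K i) Rr Hp) (fun q : BlkY i × ι => ιB q.1) (fun p : SiteY i × ι => blkC i ιB p.1)
      (FcsC i par b (.base U) (.mult a)) (fun y y' : IBondY i => (M₂ * ∑ j, ‖b j‖) * cVar * β' * (if y = y' then (1 : ℝ) else 0)) := by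
  classical
  have hSb : 0 ≤ ∑ j, ‖b j‖ := Finset.sum_nonneg fun j _ => norm_nonneg _
  set t : ℝ := cVar * β' with ht
  have ht0 : 0 ≤ t := mul_nonneg hcVar hβ
  intro y' μ B hμ p
  show |(QcsC i par b (.prod U a) - QcsC i par b (.base U)) μ p| ≤ _
  have hval : (QcsC i par b (.prod U a) - QcsC i par b (.base U)) μ p =
      b.repr (QpsY i par (decY i (.prod U a)) ((coordEquiv b).symm μ) p.1 - QpsY i par U ((coordEquiv b).symm μ) p.1) p.2 := by
    rw [LinearMap.sub_apply, Pi.sub_apply, QcsC, QcsC, conjHom_apply, conjHom_apply, LinearMap.restrictScalars_apply, LinearMap.restrictScalars_apply,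
      decY_base, map_sub, Finsupp.sub_apply]
  rw [hval, QpsY_apply, QpsY_apply]
  dsimp only
  set lam := (coordEquiv b).symm μ with hlam
  have hR := (hvar (blkY i p.1) p.1 rfl (lam (blkY i p.1))).2
  split_ifs with hq
  · have hbd : ‖lam (blkY i p.1)‖ ≤ (∑ j, ‖b j‖) * B := norm_coordSymm_apply_le b μ (blkY i p.1) B fun j => hμ.bound (blkY i p.1, j) hq
    calc |b.repr (R (qpT i par (decY i (.prod U a)) (blkY i p.1) p.1)⁻¹ (lam (blkY i p.1)) - R (qpT i par U (blkY i p.1) p.1)⁻¹ (lam (blkY i p.1))) p.2|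
        ≤ M₂ * ‖R (qpT i par (decY i (.prod U a)) (blkY i p.1) p.1)⁻¹ (lam (blkY i p.1)) - R (qpT i par U (blkY i p.1) p.1)⁻¹ (lam (blkY i p.1))‖ :=
          hrepr _ _
      _ ≤ M₂ * (t * ((∑ j, ‖b j‖) * B)) := mul_le_mul_of_nonneg_left (hR.trans (mul_le_mul_of_nonneg_left hbd ht0)) hM₂
      _ = (M₂ * ∑ j, ‖b j‖) * cVar * β' * 1 * B := by rw [ht]; ring
  · have hl0 : lam (blkY i p.1) = 0 := by
      rw [hlam, coordEquiv_symm_apply]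
      refine Finset.sum_eq_zero fun j _ => ?_
      rw [hμ.off (blkY i p.1, j) hq, zero_smul]
    rw [blkY_apply] at hl0
    rw [hl0, B9Eq39Adjoint.R_zero, B9Eq39Adjoint.R_zero, sub_zero, map_zero, Finsupp.zero_apply, abs_zero, mul_zero, zero_mul]

end Variation

/-! ## §2b The variation law DISCHARGED from g7's (3.37)-letters `CplxLettersY` for transporter tables with `U(Γ_{z,w}) = U(Γ_{w,z})⁻¹` -/

section Discharge

variable (G : Subgroup 𝔸ˣ) (x : MemberY d ℓ hd hL b₀ b₁ Mstar) (par : SiteParY 𝔸 x.toKIdx) (ιB : BlkY x.toKIdx → IBondY x.toKIdx)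

/-- ★★ **THE VARIATION LAW FROM THE (3.59) LETTERS OF THE CLASS (3.37)**: g7's `CplxLettersY` at `(U, a)` with constant `C_q` at exponent `β′` — whose first two
conjuncts ARE the operator-norm bounds `‖W_s⁻¹(R(τ′) − R(τ))‖ ≦ C_q β′ W_s⁻¹`, `‖R(U′U(Γ_{z,c})) − R(U(Γ_{z,c}))‖ ≦ C_q β′` of the (3.59) letters `kF = kQ(U′U) − kQ(U)`,
`sF = sQ(U′U) − sQ(U)` — gives `VarParY x par C_q β′ U a`, for every transporter table with the reversal law `U(Γ_{z,w}) = U(Γ_{w,z})⁻¹` (the record's `parSymY`: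
`Node00.parSymY_inv_symm`). Hence NO new law is displayed by the C⁻¹ member beyond g7's `hC37`.
[cite: Balaban1985BackgroundPropagators, (3.57)–(3.59) p.402, (3.37) p.396, (3.40) p.397] -/
theorem varParY_of_cplxLettersY (hι : ∀ s : BlkY x.toKIdx, β x.toKIdx.hN x.toKIdx.D x.toKIdx.hk (ιB s) = s)
    (hsym : ∀ (U : CfgY 𝔸 x.toKIdx) (z w : SiteY x.toKIdx), par U z w = (par U w z)⁻¹)
    {Cq β' : ℝ} {U : CfgY 𝔸 x.toKIdx} {a : AfldY 𝔸 x.toKIdx} (hC : CplxLettersY G x par ιB Cq β' U a) :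
    VarParY x.toKIdx par Cq β' U a := by
  intro s z hz E
  obtain ⟨hkF, hsF, -⟩ := hC
  have hW : 0 < wB x.toKIdx s := wB_pos x.toKIdx s
  -- (3.59) for `kF` at the block of `z`: the operator norm of `W_s⁻¹·(R(τ′) − R(τ))`
  have h1 := hkF (ιB s) z (by show ιB (blkY x.toKIdx z) = ιB s; rw [hz])
  have h1' : ‖Rclm (qpT x.toKIdx par (decY x.toKIdx (.prod U a)) s z) - Rclm (qpT x.toKIdx par U s z)‖ ≤ Cq * β' := by
    have hk : kFC x.toKIdx par (.base U) (.mult a) (ιB s) z =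
        (wB x.toKIdx s)⁻¹ • (Rclm (qpT x.toKIdx par (decY x.toKIdx (.prod U a)) s z) - Rclm (qpT x.toKIdx par U s z)) := by
      show kFY x.toKIdx par U _ (β x.toKIdx.hN x.toKIdx.D x.toKIdx.hk (ιB s)) z = _
      rw [kFY, kQY, kQY, hι, smul_sub]
      rfl
    have hw : wC x.toKIdx (.base U) (ιB s) = (wB x.toKIdx s)⁻¹ := by
      show (wB x.toKIdx (β x.toKIdx.hN x.toKIdx.D x.toKIdx.hk (ιB s)))⁻¹ = _; rw [hι]
    rw [hk, hw, norm_smul, Real.norm_eq_abs, abs_of_pos (inv_pos.2 hW), mul_comm (Cq * β')] at h1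
    exact le_of_mul_le_mul_left h1 (inv_pos.2 hW)
  -- (3.59) for `sF` at `z`: the operator norm of `R(U′U(Γ_{z,c})) − R(U(Γ_{z,c}))`, transport reversed by `hsym`
  have h2 := hsF z
  have h2' : ‖Rclm (qpT x.toKIdx par (decY x.toKIdx (.prod U a)) s z)⁻¹ - Rclm (qpT x.toKIdx par U s z)⁻¹‖ ≤ Cq * β' := by
    have hs : sFC x.toKIdx par (.base U) (.mult a) z =
        Rclm (qpT x.toKIdx par (decY x.toKIdx (.prod U a)) s z)⁻¹ - Rclm (qpT x.toKIdx par U s z)⁻¹ := by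
      show sFY x.toKIdx par U _ z = _
      rw [sFY, sQY, sQY, hz, hsym, hsym U]
      rfl
    rwa [hs] at h2
  constructor
  · have := ContinuousLinearMap.le_opNorm (Rclm (qpT x.toKIdx par (decY x.toKIdx (.prod U a)) s z) - Rclm (qpT x.toKIdx par U s z)) E
    rw [FunLike.coe_sub, Pi.sub_apply, Rclm_apply, Rclm_apply] at this
    exact this.trans (mul_le_mul_of_nonneg_right h1' (norm_nonneg _))
  · have := ContinuousLinearMap.le_opNorm (Rclm (qpT x.toKIdx par (decY x.toKIdx (.prod U a)) s z)⁻¹ - Rclm (qpT x.toKIdx par U s z)⁻¹) E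
    rw [FunLike.coe_sub, Pi.sub_apply, Rclm_apply, Rclm_apply] at this
    exact this.trans (mul_le_mul_of_nonneg_right h2' (norm_nonneg _))

end Discharge

/-! ## §3 The instance of `CinvFrame₃` over the coded carriers of a subfamily, and the (3.48) block-steps for `KSC` and ★★★ `KSCU` -/

section Instance

variable [NormOneClass 𝔸] [FiniteDimensional ℝ 𝔸] {J : Type} (f : J → MemberY d ℓ hd hL b₀ b₁ Mstar)
  [∀ x : MemberY d ℓ hd hL b₀ b₁ Mstar, Fintype (geo9Y x).Site]
  [instDS : ∀ x : MemberY d ℓ hd hL b₀ b₁ Mstar, DecidableEq (geo9Y x).Site] [instNE : ∀ x : MemberY d ℓ hd hL b₀ b₁ Mstar, Nonempty (geo9Y x).Site]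
  (c35 : ℝ) (G : Subgroup 𝔸ˣ) (par : ∀ j : J, SiteParY 𝔸 (f j).toKIdx) (OA : ∀ j : J, BondOpY 𝔸 (f j).toKIdx)
  (parB : ∀ j : J, BondParY 𝔸 (f j).toKIdx) {ι : Type} [Fintype ι] [DecidableEq ι] (b : Module.Basis ι ℝ 𝔸)
  (ιB : ∀ j : J, BlkY (f j).toKIdx → IBondY (f j).toKIdx)
  (C37 C38 : ∀ j : J, ℝ → CfgY 𝔸 (f j).toKIdx → AfldY 𝔸 (f j).toKIdx → Prop)

/-- **THE RECORD's (3.48) KERNEL FAMILY OF THE LETTER `C = CY par (GpY par)` AT THE CARRIER BLOCKS** on the subfamily: the `siteKernelOfOp` reading of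
`Node00.OpsYOfLetters` (`= (operatorLayerYOfLetters …).Cinv` at the record, whose `𝔏.C = CY (parS) (Gp)`); the `Cinv` slot of `B9SectBCodedReadingsU.SectBStepU`.
[cite: Balaban1985BackgroundPropagators, Thm 3.2 (3.48) p.398, (3.21) p.394] -/
def CinvY (j : J) : B9.SiteKernel (geo9Y (f j)) (bg9Y 𝔸 G (f j)) :=
  siteKernelOfOp (f j).toKIdx (bg9Y 𝔸 G (f j)) (fun U => U) (CY (f j).toKIdx (par j) (GpY (f j).toKIdx (par j)))
    (β (f j).toKIdx.hN (f j).toKIdx.D (f j).toKIdx.hk) (β (f j).toKIdx.hN (f j).toKIdx.D (f j).toKIdx.hk)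

omit [NormOneClass 𝔸] [FiniteDimensional ℝ 𝔸] [∀ x : MemberY d ℓ hd hL b₀ b₁ Mstar, Fintype (geo9Y x).Site] instDS instNE [DecidableEq ι] in
/-- the record's kernel read along the decoding IS `kerCY` at the decoded configuration (`rfl`). [cite: Balaban1985BackgroundPropagators, (3.48) p.398, bookkeeping] -/
theorem pullS_CinvY_ker (j : J) (c : (codingYx G (f j) (C37 j) (C38 j)).bg.Cfg) (y y' : IBondY (f j).toKIdx) :
    (pullS (codingYx G (f j) (C37 j) (C38 j)) (CinvY f G par j)).ker c y y' = kerCY (f j) (par j) (decY (f j).toKIdx c) y y' := by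
  cases c <;> rfl

/-- ★★ **THE LETTERS DICTIONARY `CinvFrame₃` OVER THE CODED CARRIERS OF A SUBFAMILY, INHABITED** for g7's coded readings `KSC` of G′, the block carrier
`P j := BlkY × ι` with block map `ι_B ∘ fst`, the letters `QcC ∕ QcsC ∕ CopC ∕ FcC ∕ FcsC` of `B9SectBKerLettersY`, kernel dimension `dB := d + 1`, and the family
`pullS 𝔠 (CinvY j)` (the record's (3.48) kernel of `C = CY par (GpY par)` read along the decoding).  Root = `gpFrame₂CodedOn` (dictionaries `read342Y_KSC` ∕
`write342Y_KSC`).  Fields: `hQc ∕ hQcs` = §3 of `B9SectBKerLettersY` (contractive transporters at a (3.35)-regular, hence `G`-valued, base); `cop_eq` = `copC_eq`;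
`reg_cinv` = `XC_mul_CopC` under the DISPLAYED invertibility `hunitX` of `(Q′G′²Q′*)(U)` at `G`-valued `U` (Thm 3.2 ∕ 3.11's regime; at the record
`B9Thm311PosAtRecordV4.isUnit_XY_parSymY`); `q_mul` = `qcC_prod ∕ qcsC_prod`; `hF` = §2 with the law supplied by §2b from `hC37` under the reversal law `hsym`; `readKer` ∕
`writeKer` = §1.  Constants: `κ_Q = M₂Σ‖b‖`, `c_F = M₂Σ‖b‖·C_q + 1`, `c_K = |ι|·M₂Σ‖b‖`, `w_K(B, δ) = M₂Σ‖b‖·B + 1`, `w_Kδ(δ) = δ`.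
[cite: Balaban1985BackgroundPropagators, Thm 3.2 (3.48) p.398, (3.19)–(3.21) pp.393–394, (3.57)–(3.59) p.402, (3.65)–(3.67) p.403, Thm 3.11 p.416; Balaban1984PropagatorsII, (2.51) p.232, (2.69) p.235] -/
noncomputable def cinvFrame₃CodedOn (hι : ∀ (j : J) (s : BlkY (f j).toKIdx), β (f j).toKIdx.hN (f j).toKIdx.D (f j).toKIdx.hk (ιB j s) = s)
    (hG1 : ∀ u : 𝔸ˣ, u ∈ G → ‖(u : 𝔸)‖ ≤ 1) (hpar : ∀ j (U : CfgY 𝔸 (f j).toKIdx), GVal G (f j).toKIdx U → ∀ z w, par j U z w ∈ G)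
    (hunit : ∀ j (U : CfgY 𝔸 (f j).toKIdx), GVal G (f j).toKIdx U → IsUnit (deltaPrimeAY (f j).toKIdx (par j) U))
    (M₂ : ℝ) (hM₂ : 0 ≤ M₂) (hrepr : ∀ (v : 𝔸) (j : ι), |b.repr v j| ≤ M₂ * ‖v‖) (hcR : 0 < M₂ * ∑ j, ‖b j‖)
    (Cq : ℝ) (hCq : 0 ≤ Cq) (hC37 : ∀ j β' U a, C37 j β' U a → GVal G (f j).toKIdx U ∧ CplxLettersY G (f j) (par j) (ιB j) Cq β' U a)
    (MInv aInv aW : ℝ) (hMInv : 0 < MInv) (haInv : 0 < aInv) (haW : 0 < aW)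
    (hunitX : ∀ j (U : CfgY 𝔸 (f j).toKIdx), GVal G (f j).toKIdx U → IsUnit (XY (f j).toKIdx (par j) (GpY (f j).toKIdx (par j)) U))
    (hsym : ∀ j (U : CfgY 𝔸 (f j).toKIdx) (z w : SiteY (f j).toKIdx), par j U z w = (par j U w z)⁻¹) :
    CinvFrame₃ c35 (fun j => geo9Y (f j)) (fun j => (codingYx G (f j) (C37 j) (C38 j)).bg) (fun j => KSC G (f j) (par j) (C37 j) (C38 j)) b (Fin (d + 1))
      (fun j => SiteY (f j).toKIdx) (fun j => BlkY (f j).toKIdx × ι) (fun j => pullS (codingYx G (f j) (C37 j) (C38 j)) (CinvY f G par j)) :=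
  { gpFrame₂CodedOn f c35 G b C37 C38 par ιB (fun j => KSC G (f j) (par j) (C37 j) (C38 j)) hι hG1 hpar hunit (d + 1) M₂ hM₂ hrepr Cq hCq hC37
      (M₂ * ∑ j, ‖b j‖) hcR (fun B _ => (M₂ * ∑ j, ‖b j‖) * B + 1) (fun B _ hB _ => by positivity) (fun δ => δ) (fun δ hδ => hδ)
      MInv aInv aW hMInv haInv haW (fun j => read342Y_KSC G (f j) (par j) b (ιB j) (C37 j) (C38 j) (hι j) M₂ hM₂ hrepr c35 MInv aInv)
      (fun j => write342Y_KSC G (f j) (par j) b (ιB j) (C37 j) (C38 j) (hι j) M₂ hM₂ hrepr aW fun β' U a h => (hC37 j β' U a h).1) with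
    blkP := fun j q => ιB j q.1
    κQ := M₂ * ∑ j, ‖b j‖
    cF := (M₂ * ∑ j, ‖b j‖) * Cq + 1
    cK := (Fintype.card ι : ℝ) * (M₂ * ∑ j, ‖b j‖)
    wK := fun B _ => (M₂ * ∑ j, ‖b j‖) * B + 1
    wKδ := fun δ => δ
    κQ_pos := hcR
    cF_pos := by positivity
    cK_pos := by
      have hne : Nonempty ι := by
        by_contra h
        rw [not_nonempty_iff] at h
        simp at hcR
      exact mul_pos (Nat.cast_pos.2 Fintype.card_pos) hcR
    wK_pos := fun B δ hB _ => by positivity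
    wKδ_pos := fun δ hδ => hδ
    Qc := fun j c => QcC (f j).toKIdx (par j) b c
    Qcs := fun j c => QcsC (f j).toKIdx (par j) b c
    Cop := fun j c => CopC (f j).toKIdx (par j) b c
    Fc := fun j c c' => FcC (f j).toKIdx (par j) b c c'
    Fcs := fun j c c' => FcsC (f j).toKIdx (par j) b c c'
    hQc := fun j α₀ c _ _ _ hreg => by
      letI : Fintype (geo9K (f j).toKIdx).Site := ‹∀ x : MemberY d ℓ hd hL b₀ b₁ Mstar, Fintype (geo9Y x).Site› (f j)
      letI : DecidableEq (geo9K (f j).toKIdx).Site := instDS (f j)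
      obtain ⟨U, rfl, hU⟩ := (codingYx G (f j) (C37 j) (C38 j)).exists_of_bg_Reg335 hreg
      refine hasMajorantHom_mono _ _ (hasMajorantHom_QcC_base (f j).toKIdx (par j) b (ιB j)
        (fun z w => norm_le_one_and_inv_of_mem G hG1 (hpar j U hU.1.1 z w)) hM₂ hrepr) fun a a' => ?_
      split_ifs <;> simp_all
    hQcs := fun j α₀ c _ _ _ hreg => by
      letI : Fintype (geo9K (f j).toKIdx).Site := ‹∀ x : MemberY d ℓ hd hL b₀ b₁ Mstar, Fintype (geo9Y x).Site› (f j)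
      letI : DecidableEq (geo9K (f j).toKIdx).Site := instDS (f j)
      obtain ⟨U, rfl, hU⟩ := (codingYx G (f j) (C37 j) (C38 j)).exists_of_bg_Reg335 hreg
      refine hasMajorantHom_mono _ _ (hasMajorantHom_QcsC_base (f j).toKIdx (par j) b (ιB j)
        (fun z w => norm_le_one_and_inv_of_mem G hG1 (hpar j U hU.1.1 z w)) hM₂ hrepr) fun a a' => ?_
      split_ifs <;> simp_all
    cop_eq := fun j c D X hD hXD hDX => copC_eq (f j).toKIdx (par j) b c D X hD hDX hXD
    reg_cinv := fun j α₀ c _ _ _ hreg => by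
      obtain ⟨U, rfl, hU⟩ := (codingYx G (f j) (C37 j) (C38 j)).exists_of_bg_Reg335 hreg
      exact (XC_mul_CopC (f j).toKIdx (par j) b (.base U) (hunitX j U hU.1.1)).1
    q_mul := fun j α₁ c c' _ h37 => by
      obtain ⟨U, a, rfl, rfl, _⟩ := (codingYx G (f j) (C37 j) (C38 j)).exists_of_bg_Cplx337 h37
      exact ⟨qcC_prod (f j).toKIdx (par j) b U a, qcsC_prod (f j).toKIdx (par j) b U a⟩
    hF := fun j α₁ c c' hα₁ h37 => by
      letI : Fintype (geo9K (f j).toKIdx).Site := ‹∀ x : MemberY d ℓ hd hL b₀ b₁ Mstar, Fintype (geo9Y x).Site› (f j)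
      letI : DecidableEq (geo9K (f j).toKIdx).Site := instDS (f j)
      obtain ⟨U, a, rfl, rfl, hC⟩ := (codingYx G (f j) (C37 j) (C38 j)).exists_of_bg_Cplx337 h37
      have hv : VarParY (f j).toKIdx (par j) Cq α₁ U a := varParY_of_cplxLettersY G (f j) (par j) (ιB j) (hι j) (hsym j) (hC37 j α₁ U a hC).2
      have h1 : (M₂ * ∑ j, ‖b j‖) * Cq * α₁ ≤ ((M₂ * ∑ j, ‖b j‖) * Cq + 1) * α₁ := by nlinarith [hα₁.le]
      constructor
      · refine hasMajorantHom_mono _ _ (hasMajorantHom_FcC (f j).toKIdx (par j) b (ιB j) (hι j) hCq hα₁.le hv hM₂ hrepr) fun y y' => ?_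
        split_ifs <;> simp_all
      · refine hasMajorantHom_mono _ _ (hasMajorantHom_FcsC (f j).toKIdx (par j) b (ιB j) hCq hα₁.le hv hM₂ hrepr) fun y y' => ?_
        split_ifs <;> simp_all
    readKer := fun j α₀ c B₁ δ _ _ _ hreg hB₁ _ hker => by
      obtain ⟨U, rfl, hU⟩ := (codingYx G (f j) (C37 j) (C38 j)).exists_of_bg_Reg335 hreg
      exact hasMajorant_CopC_base (f j) (par j) b (ιB j) (hι j) hM₂ hrepr U hB₁.le fun y y' => (le_abs_self _).trans (hker y y')
    writeKer := fun j c c' α₁ B δ _ _ h37 hB _ hmaj y y' => by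
      obtain ⟨U, a, rfl, rfl, _⟩ := (codingYx G (f j) (C37 j) (C38 j)).exists_of_bg_Cplx337 h37
      have hpos := geo9Y_len_pos (f j) y
      have hpos' := geo9Y_len_pos (f j) y'
      have h := kerCY_le_of_hasMajorant_CopC (f j) (par j) b (ιB j) (hι j) hM₂ hrepr (.prod U a) hmaj y y'
      rw [pullS_CinvY_ker, abs_of_nonneg (kerCY_nonneg (f j) (par j) _ y y')]
      exact h.trans (mul_le_mul_of_nonneg_right (mul_le_mul_of_nonneg_right (mul_le_mul_of_nonneg_right (by linarith)
        (Real.rpow_nonneg hpos.le _)) (Real.rpow_nonneg hpos'.le _)) (Real.exp_pos _).le) }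

/-- ★★ **`StepKerPos` OF THE CODED FAMILY `KSC` WITH THE RECORD's (3.48) KERNEL OF `C = CY par (GpY par)`** over the coded carriers of a subfamily (any shared
`GA`): `stepKerPos_of_cinvFrame₃` on `cinvFrame₃CodedOn` — r06's block-carrier C⁻¹ clause at def-Y's letters.  Displayed: the root frame's structural data, the
invertibility `hunitX`, the reversal law `hsym`. [cite: Balaban1985BackgroundPropagators, Thm 3.4 p.400, Thm 3.2 (3.48) p.398, (3.65)–(3.67) p.403, (3.57)–(3.59) p.402; Balaban1984PropagatorsII, Lemma 2.1 p.234, (2.51) p.232] -/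
theorem stepKerPos_KSC_cinv_on (hι : ∀ (j : J) (s : BlkY (f j).toKIdx), β (f j).toKIdx.hN (f j).toKIdx.D (f j).toKIdx.hk (ιB j s) = s)
    (hG1 : ∀ u : 𝔸ˣ, u ∈ G → ‖(u : 𝔸)‖ ≤ 1) (hpar : ∀ j (U : CfgY 𝔸 (f j).toKIdx), GVal G (f j).toKIdx U → ∀ z w, par j U z w ∈ G)
    (hunit : ∀ j (U : CfgY 𝔸 (f j).toKIdx), GVal G (f j).toKIdx U → IsUnit (deltaPrimeAY (f j).toKIdx (par j) U))
    (M₂ : ℝ) (hM₂ : 0 ≤ M₂) (hrepr : ∀ (v : 𝔸) (j : ι), |b.repr v j| ≤ M₂ * ‖v‖) (hcR : 0 < M₂ * ∑ j, ‖b j‖)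
    (Cq : ℝ) (hCq : 0 ≤ Cq) (hC37 : ∀ j β' U a, C37 j β' U a → GVal G (f j).toKIdx U ∧ CplxLettersY G (f j) (par j) (ιB j) Cq β' U a)
    (MInv aInv aW : ℝ) (hMInv : 0 < MInv) (haInv : 0 < aInv) (haW : 0 < aW)
    (hunitX : ∀ j (U : CfgY 𝔸 (f j).toKIdx), GVal G (f j).toKIdx U → IsUnit (XY (f j).toKIdx (par j) (GpY (f j).toKIdx (par j)) U))
    (hsym : ∀ j (U : CfgY 𝔸 (f j).toKIdx) (z w : SiteY (f j).toKIdx), par j U z w = (par j U w z)⁻¹)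
    (GA : ∀ j : J, B9.KernelFamily (geo9Y (f j)) (codingYx G (f j) (C37 j) (C38 j)).bg) :
    StepKerPos (d + 1) c35 (fun j => geo9Y (f j)) (fun j => (codingYx G (f j) (C37 j) (C38 j)).bg) (fun j => KSC G (f j) (par j) (C37 j) (C38 j)) GA
      (fun j => pullS (codingYx G (f j) (C37 j) (C38 j)) (CinvY f G par j)) (fun j => pullS (codingYx G (f j) (C37 j) (C38 j)) (CinvY f G par j)) :=
  stepKerPos_of_cinvFrame₃ _ _ _ _ _ _ _ _
    (cinvFrame₃CodedOn f c35 G par b ιB C37 C38 hι hG1 hpar hunit M₂ hM₂ hrepr hcR Cq hCq hC37 MInv aInv aW hMInv haInv haW hunitX hsym) GA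

/-- ★★★ **THE (3.48) MEMBER OF `SectBStepU` (R13-U1): `StepKerPos` OF `(KSCU, KACU, C⁻¹)` OVER THE CODED CARRIERS** — input families the U-letter readings
`KSCU`, `KACU` and the record's (3.48) kernel of `C = CY par (GpY par)` read along the decoding, output the same kernel at the product `U′U`:
`stepKerPos_KSC_cinv_on` transported by `B9SectBStepPosFamilyTransfer.stepKerPos_of_family_pos` (`hin_KSCU_on_pos`; identity output, the kernel is shared).
Displayed: the root frame's structural data (as `stepEPos_KSCU_on`), `hunitX`, `hsym`. [cite: Balaban1985BackgroundPropagators, Thm 3.4 p.400, Thm 3.2 (3.48) p.398, (3.65)–(3.67) p.403, p.403 l.1–9, (3.35)–(3.37) p.396; Balaban1984PropagatorsII, Lemma 2.1 p.234, (2.51) p.232] -/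
theorem stepKerPos_KSCU_on (hι : ∀ (j : J) (s : BlkY (f j).toKIdx), β (f j).toKIdx.hN (f j).toKIdx.D (f j).toKIdx.hk (ιB j s) = s)
    (hG1 : ∀ u : 𝔸ˣ, u ∈ G → ‖(u : 𝔸)‖ ≤ 1) (hpar : ∀ j (U : CfgY 𝔸 (f j).toKIdx), GVal G (f j).toKIdx U → ∀ z w, par j U z w ∈ G)
    (hunit : ∀ j (U : CfgY 𝔸 (f j).toKIdx), GVal G (f j).toKIdx U → IsUnit (deltaPrimeAY (f j).toKIdx (par j) U))
    (M₂ : ℝ) (hM₂ : 0 ≤ M₂) (hrepr : ∀ (v : 𝔸) (j : ι), |b.repr v j| ≤ M₂ * ‖v‖) (hcR : 0 < M₂ * ∑ j, ‖b j‖)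
    (Cq : ℝ) (hCq : 0 ≤ Cq) (hC37 : ∀ j β' U a, C37 j β' U a → GVal G (f j).toKIdx U ∧ CplxLettersY G (f j) (par j) (ιB j) Cq β' U a)
    (MInv aInv aW : ℝ) (hMInv : 0 < MInv) (haInv : 0 < aInv) (haW : 0 < aW)
    (hunitX : ∀ j (U : CfgY 𝔸 (f j).toKIdx), GVal G (f j).toKIdx U → IsUnit (XY (f j).toKIdx (par j) (GpY (f j).toKIdx (par j)) U))
    (hsym : ∀ j (U : CfgY 𝔸 (f j).toKIdx) (z w : SiteY (f j).toKIdx), par j U z w = (par j U w z)⁻¹) :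
    StepKerPos (d + 1) c35 (fun j => geo9Y (f j)) (fun j => (codingYx G (f j) (C37 j) (C38 j)).bg)
      (fun j => KSCU G (f j) (par j) (C37 j) (C38 j)) (fun j => KACU G (f j) (OA j) (parB j) (C37 j) (C38 j))
      (fun j => pullS (codingYx G (f j) (C37 j) (C38 j)) (CinvY f G par j)) (fun j => pullS (codingYx G (f j) (C37 j) (C38 j)) (CinvY f G par j)) :=
  stepKerPos_of_family_pos (d + 1) c35 (fun j => geo9Y (f j)) (fun j => (codingYx G (f j) (C37 j) (C38 j)).bg)
    (fun j => KSC G (f j) (par j) (C37 j) (C38 j)) (fun j => KSCU G (f j) (par j) (C37 j) (C38 j))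
    (fun j => KACU G (f j) (OA j) (parB j) (C37 j) (C38 j)) (fun j => KACU G (f j) (OA j) (parB j) (C37 j) (C38 j))
    (fun j => pullS (codingYx G (f j) (C37 j) (C38 j)) (CinvY f G par j))
    (hin_KSCU_on_pos f c35 G par OA parB b ιB C37 C38 (CinvY f G par) hι hG1 hM₂ hrepr (d + 1))
    (fun j => pullS (codingYx G (f j) (C37 j) (C38 j)) (CinvY f G par j)) (fun j => pullS (codingYx G (f j) (C37 j) (C38 j)) (CinvY f G par j))
    (fun B δ a hB hδ ha => ⟨0, 1, a, B, δ, one_pos, ha, le_rfl, hB, hδ, fun _ _ _ _ _ _ _ _ _ _ _ _ hK => hK⟩)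
    (stepKerPos_KSC_cinv_on f c35 G par b ιB C37 C38 hι hG1 hpar hunit M₂ hM₂ hrepr hcR Cq hCq hC37 MInv aInv aW hMInv haInv haW hunitX hsym _)

end Instance

end Literature.MathematicalPhysics.QuantumFieldTheory.Balaban1983to89.B9SectBKerFrameCodedY
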